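import Summits.RiemannHypothesis.RiemannHypothesis.Theses.SpectralTrace
import Summits.RiemannHypothesis.RiemannHypothesis.Theorems.SpectralIsHpSpectrum.Negative.RefutationImpliesRH
import Summits.RiemannHypothesis.RiemannHypothesis.Theorems.WindowTraceArch.Negative.ComplexSpectrum
import Literature.NumberTheory.LFunctions.WeilMellinBounds
import HarnessLib

/-!
# Line `self-majorant-peak` for the crux `SpectralTrace.SpectralIsHpSpectrum` (stmt-RiemannHypothesis-0195)

Lead's skeleton (prover-line-stmt-RiemannHypothesis-0195-0, 2026-08-16). The crux:
`∀ ι (γ : ι → ℝ), (∀ Weil g, HasSum (i ↦ ĝ(1/2+iγ_i)) (W g)) →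
   ∀ z, {i | 1/2 + iγ_i = z}.encard = 𝟙_{non-trivial zeros}(z) · analyticOrderNatAt ζ z`.

Lever (idea card `Ideas/self-majorant-peak.md`, crux-ideate ideator 2 gen 2; complete kernel-checked
evidence `Cruxes/SpectralIsHpSpectrum/SelfMajorantComplete.lean`): a real spectrum of ANY functional
`L` on the Weil tests is absolutely summable against every test (`HasSum` in `ℂ` is unconditional),
so the trace of `g ⋆ q_n` against a modulated-dilated peak sequence `q_n` is its own Tannery
majorant and converges to `#{i | γ_i = x} · c · ĝ(1/2+ix)`; two real spectra of the same `L`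
therefore have the same fibre counts (STUB 1, W-free). Under RH (which the crux hypothesis proves,
landed `riemannHypothesis_of_trace`) the zeta ordinates with multiplicity are a second real
spectrum of `W` (`hasSum_weilMellin_zeros`, `eq_half_add_of_riemannHypothesis`) whose fibre
`encard` is the crux's right-hand side (STUB 2, pure bookkeeping on `riemannZetaZeroOrder` vs
`analyticOrderNatAt`). Both stubs are stated in TREE VOCABULARY ONLY (no line-local definition), so
the Theorems files proving them verbatim stay definition-free.

Registered stubs (sorry ONLY here):
* `stub_encardFibreEq` — two real spectra of one functional have equal fibre `encard`s (the
  analysis; Theorems file `SpectralTraceSpectralIsHpSpectrumPeak.lean`).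
* `stub_encardOrdinatesFibre` — under RH, the fibre `encard` of the canonical family over `τ` is
  the indicator-multiplicity at `1/2 + iτ` (Theorems file `SpectralTraceSpectralIsHpSpectrum.lean`).

Composition `SpectralIsHpSpectrum_of : stub 1 → stub 2 → SpectralIsHpSpectrum` is sorry-free below
and concludes the route decl BY NAME.
-/

noncomputable section

open Complex Set MeasureTheory Filter
open scoped Topology

namespace Summit.RiemannHypothesis.RiemannHypothesis.Cruxes.SpectralIsHpSpectrum.SelfMajorantPeak

open Literature.NumberTheory.LFunctions
open Summit.RiemannHypothesis.RiemannHypothesis.Theorems.WindowTraceArch.Negative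
open Summit.RiemannHypothesis.RiemannHypothesis.Theorems.SpectralIsHpSpectrum.Negative
  (riemannHypothesis_of_trace)

/-! ## Stub statements (named `Prop`s) -/

/-- Statement of STUB 1 (W-free uniqueness of multiplicities): two real spectra `γ, γ'` of the
SAME functional `L` on the Weil tests have equal fibre `encard`s at every real point. [folklore] -/
def EncardFibreEq : Prop :=
  ∀ (ι ι' : Type) (γ : ι → ℝ) (γ' : ι' → ℝ) (L : (ℝ → ℂ) → ℂ),
    (∀ g : ℝ → ℂ, IsWeilTest g →
      HasSum (fun i => weilMellin g (1 / 2 + (γ i : ℂ) * I)) (L g)) →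
    (∀ g : ℝ → ℂ, IsWeilTest g →
      HasSum (fun j => weilMellin g (1 / 2 + (γ' j : ℂ) * I)) (L g)) →
    ∀ x : ℝ, {i | γ i = x}.encard = {j | γ' j = x}.encard

/-- Statement of STUB 2 (bookkeeping under RH): the fibre `encard` over `τ` of the canonical
family — non-trivial zeros repeated `m(ρ)` times, read through `Im` — is the crux's right-hand
side at `1/2 + iτ`. [folklore] -/
def EncardOrdinatesFibre : Prop :=
  _root_.RiemannHypothesis → ∀ τ : ℝ,
    {p : (Σ ρ : ZetaZeros.riemannZetaNontrivialZeros, Fin (riemannZetaZeroOrder (ρ : ℂ)).toNat) |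
        (p.1 : ℂ).im = τ}.encard =
      ZetaZeros.riemannZetaNontrivialZeros.indicator
        (fun w => (analyticOrderNatAt riemannZeta w : ℕ∞)) (1 / 2 + τ * I)

/-! ## The registered stubs (`sorry` lives only in these two theorems) -/

/-- **STUB 1 · `stub_encardFibreEq`** (= `EncardFibreEq` verbatim) — self-majorised Tannery peak
limit; size M (≈ 250 lines, all closed in the lead's `work/Peak.lean`). [folklore] -/
theorem stub_encardFibreEq :
    ∀ (ι ι' : Type) (γ : ι → ℝ) (γ' : ι' → ℝ) (L : (ℝ → ℂ) → ℂ),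
      (∀ g : ℝ → ℂ, IsWeilTest g →
        HasSum (fun i => weilMellin g (1 / 2 + (γ i : ℂ) * I)) (L g)) →
      (∀ g : ℝ → ℂ, IsWeilTest g →
        HasSum (fun j => weilMellin g (1 / 2 + (γ' j : ℂ) * I)) (L g)) →
      ∀ x : ℝ, {i | γ i = x}.encard = {j | γ' j = x}.encard := by
  sorry

/-- **STUB 2 · `stub_encardOrdinatesFibre`** (= `EncardOrdinatesFibre` verbatim) — counting the
canonical family; size S (≈ 80 lines, closed in the lead's `work/Closing.lean`). [folklore] -/
theorem stub_encardOrdinatesFibre :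
    _root_.RiemannHypothesis → ∀ τ : ℝ,
      {p : (Σ ρ : ZetaZeros.riemannZetaNontrivialZeros, Fin (riemannZetaZeroOrder (ρ : ℂ)).toNat) |
          (p.1 : ℂ).im = τ}.encard =
        ZetaZeros.riemannZetaNontrivialZeros.indicator
          (fun w => (analyticOrderNatAt riemannZeta w : ℕ∞)) (1 / 2 + τ * I) := by
  sorry

/-- STUB 1 is its named statement, definitionally. [folklore] -/
theorem encardFibreEq_holds : EncardFibreEq := stub_encardFibreEq

/-- STUB 2 is its named statement, definitionally. [folklore] -/
theorem encardOrdinatesFibre_holds : EncardOrdinatesFibre := stub_encardOrdinatesFibre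

namespace Registered

/-- Name-keyed alias of STUB 1 for the hypotheses of `SpectralIsHpSpectrum_of`. [folklore] -/
abbrev stub_encardFibreEq : Prop := EncardFibreEq

/-- Name-keyed alias of STUB 2 for the hypotheses of `SpectralIsHpSpectrum_of`. [folklore] -/
abbrev stub_encardOrdinatesFibre : Prop := EncardOrdinatesFibre

end Registered

/-! ## The composition (sorry-free) -/

/-- **`SpectralIsHpSpectrum_of`** — STUBS 1–2 ⇒ the crux, BY NAME. RH from the hypothesis
(`riemannHypothesis_of_trace`); off the critical line both sides vanish (empty fibre; no
non-trivial zero off the line under RH, `eq_half_add_of_riemannHypothesis`); on the line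
`z = 1/2 + iτ` the fibre is `{i | γ_i = τ}`, STUB 1 compares it with the canonical real spectrum
of `W` (`hasSum_weilMellin_zeros` + `eq_half_add_of_riemannHypothesis`) and STUB 2 evaluates the
latter. [folklore] -/
theorem SpectralIsHpSpectrum_of (h1 : Registered.stub_encardFibreEq)
    (h2 : Registered.stub_encardOrdinatesFibre) :
    Summit.RiemannHypothesis.RiemannHypothesis.Theses.SpectralTrace.SpectralIsHpSpectrum := by
  intro ι γ hγ z
  have hRH : _root_.RiemannHypothesis := riemannHypothesis_of_trace hγ
  by_cases hz : z.re = 1 / 2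
  · obtain ⟨τ, rfl⟩ : ∃ τ : ℝ, z = 1 / 2 + (τ : ℂ) * I :=
      ⟨z.im, by apply Complex.ext <;> simp [hz]⟩
    have hfib : {i : ι | (1 / 2 : ℂ) + (γ i : ℂ) * I = 1 / 2 + (τ : ℂ) * I} = {i | γ i = τ} := by
      ext i
      simp only [Set.mem_setOf_eq]
      constructor
      · intro h
        have := congrArg Complex.im h
        simpa using this
      · intro h
        rw [h]
    have hord : ∀ g : ℝ → ℂ, IsWeilTest g →
        HasSum (fun p : (Σ ρ : ZetaZeros.riemannZetaNontrivialZeros,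
          Fin (riemannZetaZeroOrder (ρ : ℂ)).toNat) =>
            weilMellin g (1 / 2 + (((p.1 : ℂ).im : ℝ) : ℂ) * I)) (weilFunctional g) :=
      fun g hg => by
        simpa only [eq_half_add_of_riemannHypothesis hRH] using hasSum_weilMellin_zeros hg
    have key := h1 ι (Σ ρ : ZetaZeros.riemannZetaNontrivialZeros,
      Fin (riemannZetaZeroOrder (ρ : ℂ)).toNat) γ (fun p => (p.1 : ℂ).im) weilFunctional hγ hord τ
    rw [hfib, key]
    exact h2 hRH τ
  · have hfib : {i : ι | (1 / 2 : ℂ) + (γ i : ℂ) * I = z} = ∅ := by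
      ext i
      simp only [Set.mem_setOf_eq, Set.mem_empty_iff_false, iff_false]
      intro h
      apply hz
      have := congrArg Complex.re h
      simp at this
      linarith
    have hnot : z ∉ ZetaZeros.riemannZetaNontrivialZeros := by
      intro hmem
      apply hz
      have h1' := eq_half_add_of_riemannHypothesis hRH ⟨z, hmem⟩
      have := congrArg Complex.re h1'
      simp at this
      linarith
    rw [hfib, Set.encard_empty, Set.indicator_of_notMem hnot]

/-- Wiring check: the registered stubs feed `SpectralIsHpSpectrum_of` as stated. -/
example : Summit.RiemannHypothesis.RiemannHypothesis.Theses.SpectralTrace.SpectralIsHpSpectrum :=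
  SpectralIsHpSpectrum_of stub_encardFibreEq stub_encardOrdinatesFibre

end Summit.RiemannHypothesis.RiemannHypothesis.Cruxes.SpectralIsHpSpectrum.SelfMajorantPeak

end
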